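import Mathlib
import HarnessLib
import Summits.HubbardSuperconductivity.HubbardSuperconductivity.Theorems.KLProgrammeKLRegimeEnginePackageRaiseDoors
import Summits.HubbardSuperconductivity.HubbardSuperconductivity.Theorems.KLProgrammeKLRegimeTwoLegCurvatureJetX

/-!
# K3 ENGINE package v6 — `klEngGeo6 := klEngGeo5.raiseTwoLeg klS6 klSL6`, `klEngQ6 P R := (klEngQ5 P R).raiseCE (klCE6 P R) (klS6' P R)`:
# the RAISED two-leg size fields of the v5 / engine-flow registration (plan g16 (R25)(b)(c)(iv), (R25′)(A), K3-FLOW RULING F (5)(S4)(a):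
# «package (klEngGeo6, klEngQ6) … kept — inputs (i) c4a-1 consts, (iv) k3c2-p2 DefsG6Q6, (vii) klWtBudget STILL WANTED, unchanged names/arities»)
# (cell gate-hubbard-kl, seat hubbard-kl-k3c2-p2 g7)

WHY.  Stub 6 of the engine child (`TwoLegCurveJetBound L M klC4aJetC (klC4aJetC' P R) …` at c4a-1's NATURAL constant tables, resp. its flow twin
`TwoLegReadJetsF`) feeds the two-leg consumers through r2d-p1's DIVIDED chain-rule fit, which reads the package's size fields divided by the loss table
`klJetX = (4441, 2.6·10¹¹, 3.6·10¹⁰, 1, 1, …)` (`…TwoLegCurvatureJetX`, p520249).  The two PACKAGE INEQUALITIES that make the insert (E3a)-feeding are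
`klJetX k · klC4aJetC k ≤ G.S k` and `klJetX k · klC4aJetC′ P R k ≤ Q.S′ k`; `S`, `S′`, `CE` are FREE UPWARD (every child is `∀ G … G.WF → …`), so the
v6 package raises them to GENEROUS POWERS OF TWO with one-line sufficiency pointers, exactly as `klE1CE` was typed before its proof:

* §1 the tables: **`klS6 j := 2^64`**, **`klSL6 := 2^64`**, **`klCE6 P R := 2^20·(klEngQ5 P R).CE`**, **`klS6' P R j := 2^64·(klEngQ5 P R).S′ j`**
  (= `2^124·klEngPsq P²·klEngRsq R²`); `klJetX_le_two_pow` (`klJetX k ≤ 2^38`), and the SUFFICIENCY POINTERS **`klJetX_mul_le_klS6`**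
  (`0 ≤ c ≤ 2^26 ⇒ klJetX k·c ≤ klS6 k`) / **`klJetX_mul_le_klS6'`** (`0 ≤ c′ ≤ 2^26·(klEngQ5 P R).S′ k ⇒ klJetX k·c′ ≤ klS6′ P R k`) — the named
  instances `klJetX_mul_C4aJetC_le_S6` / `…'_le_S6'` are one-liners from these the hour c4a-1's table `…TwoLegCurvatureConsts` lands (any
  `klC4aJetC k ≤ 2^26`, `klC4aJetC′ P R k ≤ 2^86·klEngPsq P²·klEngRsq R²`; a larger table is met by a one-line successor package — free upward);
* §2 `klEngGeo6`, `klEngGeo6_wf`, `klEngQ6`, `klEngQ6_wf`, field rows (`CF/cE4/bhi/ppGain/phGain/CR` untouched), `klS6_le_klEngGeo6_S`, `klCE6_le_klEngQ6_CE`,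
  `klS6'_le_klEngQ6_S'`, the divided forms `le_klEngGeo6_S_div_klJetX` / `le_klEngQ6_S'_div_klJetX`, `klE4T_le_klEngGeo6_cE4`, `klIsoT_pow_four_le_klEngGeo6_CF`;
* §3 the instantiated PackageRaiseDoors (p510530): `engineBoundsAtV10S_klEng6_of_klEng5`, `kernelNormsV4_klEngQ6_of_klEngQ5`, `scaleZeroConj_klEng6_of_klEng5`,
  `stepValuesConj_klEng6_of_klEng5`, `twoLegCoreTD_klEng6_of_klEng5`, `twoLegSizesMSTQ_klEng6_of_klEng5`, `klvr11_pairValueIncrement_inClass_klEng6`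
  (conclusion-side lifts; HistP-at-G6 hypotheses do NOT follow from HistP-at-G5 by monotonicity — see the DOOR-LIFT CENSUS, HOME/STATUS k3c2-p2 g7).

Definitions with bodies + order-preserving inequalities; nothing about the model is asserted; nothing asserts superconductivity.
-/

noncomputable section

namespace Summit.HubbardSuperconductivity.HubbardSuperconductivity.Theorems.EngineV8

set_option linter.dupNamespace false -- summit = problem name (single-conjunct summit), D-0017

open Real Finset Literature.MathematicalPhysics.QuantumLattice Literature.Probability.LatticeModels
open Summit.HubbardSuperconductivity.HubbardSuperconductivity.Theorems.KLRegimeSplit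
open Summit.HubbardSuperconductivity.HubbardSuperconductivity.Theorems.KLProgrammeLegKernels

/-! ## §1 The raised tables (generous powers of two) and the sufficiency pointers -/

/-- **`klS6 j := 2^64`** — the raised two-leg size fields `S_j` (every jet order; free upward). -/
def klS6 (_j : ℕ) : ℝ := (2 : ℝ) ^ 64

/-- **`klSL6 := 2^64`** — the raised frame-Lipschitz field. -/
def klSL6 : ℝ := (2 : ℝ) ^ 64

/-- **`klCE6 P R := 2^20·(klEngQ5 P R).CE`** — the raised tree-expansion constant (room for the (E1-W) budget / two-leg slot lines; free upward). -/
def klCE6 (P : SplitConsts) (R : RenConsts) : ℝ := (2 : ℝ) ^ 20 * (klEngQ5 P R).CE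

/-- **`klS6' P R j := 2^64·(klEngQ5 P R).S′ j`** (`= 2^124·klEngPsq P²·klEngRsq R²`) — the raised `|U|`-slacks of the two-leg sizes. -/
def klS6' (P : SplitConsts) (R : RenConsts) (j : ℕ) : ℝ := (2 : ℝ) ^ 64 * (klEngQ5 P R).S' j

/-- `klS6 j = 2^64`. -/
theorem klS6_eq (j : ℕ) : klS6 j = 2 ^ 64 := rfl
/-- `klS6' P R j = 2^64·(klEngQ5 P R).S′ j`. -/
theorem klS6'_eq (P : SplitConsts) (R : RenConsts) (j : ℕ) : klS6' P R j = 2 ^ 64 * (klEngQ5 P R).S' j := rfl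
/-- `0 ≤ klS6 j`. -/
theorem klS6_nonneg (j : ℕ) : 0 ≤ klS6 j := by unfold klS6; positivity
/-- `0 ≤ klSL6`. -/
theorem klSL6_nonneg : 0 ≤ klSL6 := by unfold klSL6; positivity
/-- `0 ≤ klCE6 P R`. -/
theorem klCE6_nonneg (P : SplitConsts) (R : RenConsts) : 0 ≤ klCE6 P R := by
  unfold klCE6; exact mul_nonneg (by positivity) (klEngQ5_wf P R).1
/-- `0 ≤ (klEngQ5 P R).S′ j` (local copy; the tree's `klEngQ5_S'_nonneg` lives in a two-leg door module not imported here). -/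
private theorem klg6_S'5_nonneg (P : SplitConsts) (R : RenConsts) (j : ℕ) : 0 ≤ (klEngQ5 P R).S' j := (klEngQ5_wf P R).2.2.2.2.1 j
/-- `0 ≤ klS6' P R j`. -/
theorem klS6'_nonneg (P : SplitConsts) (R : RenConsts) (j : ℕ) : 0 ≤ klS6' P R j := by
  unfold klS6'; exact mul_nonneg (by positivity) (klg6_S'5_nonneg P R j)

/-- **`klJetX k ≤ 2^38`** (`4441, 2.6·10¹¹, 3.6·10¹⁰, 1 ≤ 2^38 = 274 877 906 944`). -/
theorem klJetX_le_two_pow (k : ℕ) : klJetX k ≤ 2 ^ 38 := by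
  unfold klJetX; split_ifs <;> norm_num

/-- **Sufficiency pointer for `G.S`**: any jet table with `0 ≤ c ≤ 2^26` at order `k` satisfies the package inequality `klJetX k·c ≤ klS6 k`
(so `klJetX_mul_C4aJetC_le_S6` is this lemma at `c := klC4aJetC k` once that table is landed with values `≤ 2^26 ≈ 6.7·10⁷`). -/
theorem klJetX_mul_le_klS6 {c : ℝ} (hc0 : 0 ≤ c) (hc : c ≤ 2 ^ 26) (k : ℕ) : klJetX k * c ≤ klS6 k := by
  rw [klS6_eq]
  calc klJetX k * c ≤ 2 ^ 38 * 2 ^ 26 := mul_le_mul (klJetX_le_two_pow k) hc hc0 (by positivity)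
    _ = 2 ^ 64 := by norm_num

/-- **Sufficiency pointer for `Q.S′`**: any slack table with `0 ≤ c′ ≤ 2^26·(klEngQ5 P R).S′ k` satisfies `klJetX k·c′ ≤ klS6′ P R k`. -/
theorem klJetX_mul_le_klS6' {P : SplitConsts} {R : RenConsts} {c' : ℝ} (hc0 : 0 ≤ c') (k : ℕ) (hc : c' ≤ 2 ^ 26 * (klEngQ5 P R).S' k) :
    klJetX k * c' ≤ klS6' P R k := by
  rw [klS6'_eq]
  have hS := klg6_S'5_nonneg P R k
  calc klJetX k * c' ≤ 2 ^ 38 * (2 ^ 26 * (klEngQ5 P R).S' k) := mul_le_mul (klJetX_le_two_pow k) hc hc0 (by positivity)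
    _ = 2 ^ 64 * (klEngQ5 P R).S' k := by ring

/-! ## §2 The packages -/

/-- **`klEngGeo6 := klEngGeo5.raiseTwoLeg klS6 klSL6`.** -/
def klEngGeo6 : GeoConsts := klEngGeo5.raiseTwoLeg klS6 klSL6

/-- `klEngGeo6 = klEngGeo5.raiseTwoLeg klS6 klSL6` (`rfl`). -/
theorem klEngGeo6_eq : klEngGeo6 = klEngGeo5.raiseTwoLeg klS6 klSL6 := rfl

/-- **`klEngGeo6` is well formed.** -/
theorem klEngGeo6_wf : klEngGeo6.WF := GeoConsts.raiseTwoLeg_wf klEngGeo5_wf _ _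

/-- **`klEngQ6 P R := (klEngQ5 P R).raiseCE (klCE6 P R) (klS6' P R)`.** -/
def klEngQ6 (P : SplitConsts) (R : RenConsts) : EngConsts := (klEngQ5 P R).raiseCE (klCE6 P R) (klS6' P R)

/-- `klEngQ6 P R = (klEngQ5 P R).raiseCE …` (`rfl`). -/
theorem klEngQ6_eq (P : SplitConsts) (R : RenConsts) : klEngQ6 P R = (klEngQ5 P R).raiseCE (klCE6 P R) (klS6' P R) := rfl

/-- **`klEngQ6 P R` is well formed.** -/
theorem klEngQ6_wf (P : SplitConsts) (R : RenConsts) : (klEngQ6 P R).WF := EngConsts.raiseCE_wf (klEngQ5_wf P R) _ _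

/-- `klS6 j ≤ klEngGeo6.S j` — the raised sizes are available at the package. -/
theorem klS6_le_klEngGeo6_S (j : ℕ) : klS6 j ≤ klEngGeo6.S j := GeoConsts.le_raiseTwoLeg_S klEngGeo5 klS6 klSL6 j
/-- `klEngGeo5.S j ≤ klEngGeo6.S j`. -/
theorem klEngGeo5_S_le_klEngGeo6_S (j : ℕ) : klEngGeo5.S j ≤ klEngGeo6.S j := GeoConsts.S_le_raiseTwoLeg_S klEngGeo5 klS6 klSL6 j
/-- `klCE6 P R ≤ (klEngQ6 P R).CE`. -/
theorem klCE6_le_klEngQ6_CE (P : SplitConsts) (R : RenConsts) : klCE6 P R ≤ (klEngQ6 P R).CE := EngConsts.le_raiseCE_CE _ _ _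
/-- `(klEngQ5 P R).CE ≤ (klEngQ6 P R).CE`. -/
theorem klEngQ5_CE_le_klEngQ6_CE (P : SplitConsts) (R : RenConsts) : (klEngQ5 P R).CE ≤ (klEngQ6 P R).CE := EngConsts.CE_le_raiseCE_CE _ _ _
/-- `klS6' P R j ≤ (klEngQ6 P R).S' j`. -/
theorem klS6'_le_klEngQ6_S' (P : SplitConsts) (R : RenConsts) (j : ℕ) : klS6' P R j ≤ (klEngQ6 P R).S' j := EngConsts.le_raiseCE_S' _ _ _ j
/-- **Divided form for `G.S`** ((R25′)(A)): `0 ≤ c ≤ 2^26 ⇒ c ≤ klEngGeo6.S k / klJetX k`. -/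
theorem le_klEngGeo6_S_div_klJetX {c : ℝ} (hc0 : 0 ≤ c) (hc : c ≤ 2 ^ 26) (k : ℕ) : c ≤ klEngGeo6.S k / klJetX k := by
  rw [le_div_iff₀ (klJetX_pos k), mul_comm]
  exact (klJetX_mul_le_klS6 hc0 hc k).trans (klS6_le_klEngGeo6_S k)
/-- **Divided form for `Q.S′`**: `0 ≤ c′ ≤ 2^26·(klEngQ5 P R).S′ k ⇒ c′ ≤ (klEngQ6 P R).S′ k / klJetX k`. -/
theorem le_klEngQ6_S'_div_klJetX {P : SplitConsts} {R : RenConsts} {c' : ℝ} (hc0 : 0 ≤ c') (k : ℕ) (hc : c' ≤ 2 ^ 26 * (klEngQ5 P R).S' k) :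
    c' ≤ (klEngQ6 P R).S' k / klJetX k := by
  rw [le_div_iff₀ (klJetX_pos k), mul_comm]
  exact (klJetX_mul_le_klS6' hc0 k hc).trans (klS6'_le_klEngQ6_S' P R k)
/-- `(klEngQ6 P R).CR = (klEngQ5 P R).CR` (untouched). -/
theorem klEngQ6_CR (P : SplitConsts) (R : RenConsts) : (klEngQ6 P R).CR = (klEngQ5 P R).CR := rfl
/-- untouched `G`-fields (via `raiseTwoLeg`). -/
theorem klEngGeo6_CF : klEngGeo6.CF = klEngGeo5.CF := rfl
/-- `klEngGeo6.cE4 = klEngGeo5.cE4`. -/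
theorem klEngGeo6_cE4 : klEngGeo6.cE4 = klEngGeo5.cE4 := rfl
/-- `klEngGeo6.bhi = klEngGeo5.bhi`. -/
theorem klEngGeo6_bhi : klEngGeo6.bhi = klEngGeo5.bhi := rfl
/-- `klEngGeo6.ppGain = klEngGeo5.ppGain`. -/
theorem klEngGeo6_ppGain : klEngGeo6.ppGain = klEngGeo5.ppGain := rfl
/-- `klEngGeo6.phGain = klEngGeo5.phGain`. -/
theorem klEngGeo6_phGain : klEngGeo6.phGain = klEngGeo5.phGain := rfl
/-- `klE4T ≤ klEngGeo6.cE4`. -/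
theorem klE4T_le_klEngGeo6_cE4 : klE4T ≤ klEngGeo6.cE4 := klE4T_le_klEngGeo5_cE4
/-- `klIsoT ^ 4 ≤ klEngGeo6.CF`. -/
theorem klIsoT_pow_four_le_klEngGeo6_CF : klIsoT ^ 4 ≤ klEngGeo6.CF := klIsoT_pow_four_le_klEngGeo5_CF

/-! ## §3 The doors `(klEngGeo5, klEngQ5) ⟶ (klEngGeo6, klEngQ6)` -/

section Model

variable {L M : ℕ} [NeZero L] [NeZero M] {P : SplitConsts} {R : RenConsts} {β U μ : ℝ} {K : TrigPolyC4v} {n : ℕ}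

/-- **The V10 engine slot lifts** (`P.WF`). -/
theorem engineBoundsAtV10S_klEng6_of_klEng5 (hP : P.WF) (h : EngineBoundsAtV10S L M klEngGeo5 P (klEngQ5 P R) β U μ K n) :
    EngineBoundsAtV10S L M klEngGeo6 P (klEngQ6 P R) β U μ K n :=
  klEng_engineBoundsAtV10S_raise_of _ _ _ _ hP h

omit [NeZero M] in
/-- (E1-v4) lifts (`P.WF`). -/
theorem kernelNormsV4_klEngQ6_of_klEngQ5 (hP : P.WF) (h : KernelNormsV4 L M P (klEngQ5 P R) β U μ K n) :
    KernelNormsV4 L M P (klEngQ6 P R) β U μ K n :=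
  klEng_kernelNormsV4_raise_of _ _ hP h

/-- **`stub_engine_scale0`'s conclusion lifts** (`P.WF`). -/
theorem scaleZeroConj_klEng6_of_klEng5 (hP : P.WF)
    (h : KernelNormsV4 L M P (klEngQ5 P R) β U μ K 0 ∧ PairLadderStepAtV10 L M klEngGeo5 P (klEngQ5 P R) β U μ K 0 ∧
      QuarticValueUVAtS3 L M klEngGeo5 P (klEngQ5 P R) β U μ K 0 ∧ EngineFirstMoments L M klEngGeo5 P (klEngQ5 P R) β U μ K 0 ∧
        IsoTupleL1AtS L M klEngGeo5 P β U μ K 0) :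
    KernelNormsV4 L M P (klEngQ6 P R) β U μ K 0 ∧ PairLadderStepAtV10 L M klEngGeo6 P (klEngQ6 P R) β U μ K 0 ∧
      QuarticValueUVAtS3 L M klEngGeo6 P (klEngQ6 P R) β U μ K 0 ∧ EngineFirstMoments L M klEngGeo6 P (klEngQ6 P R) β U μ K 0 ∧
        IsoTupleL1AtS L M klEngGeo6 P β U μ K 0 :=
  klEng_scaleZeroConj_raise_of _ _ _ _ hP h

/-- **`stub_engine_step_values`' conclusion lifts.** -/
theorem stepValuesConj_klEng6_of_klEng5
    (h : PairLadderStepAtV10 L M klEngGeo5 P (klEngQ5 P R) β U μ K n ∧ PairValueIncrementAtV7 L M klEngGeo5 P (klEngQ5 P R) β U μ K n ∧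
      QuarticValueIncrementAtS4 L M klEngGeo5 P (klEngQ5 P R) β U μ K n ∧ EngineFirstMoments L M klEngGeo5 P (klEngQ5 P R) β U μ K n ∧
        IsoTupleL1AtS L M klEngGeo5 P β U μ K n) :
    PairLadderStepAtV10 L M klEngGeo6 P (klEngQ6 P R) β U μ K n ∧ PairValueIncrementAtV7 L M klEngGeo6 P (klEngQ6 P R) β U μ K n ∧
      QuarticValueIncrementAtS4 L M klEngGeo6 P (klEngQ6 P R) β U μ K n ∧ EngineFirstMoments L M klEngGeo6 P (klEngQ6 P R) β U μ K n ∧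
        IsoTupleL1AtS L M klEngGeo6 P β U μ K n :=
  klEng_stepValuesConj_raise_of _ _ _ _ h

/-- The two-leg core at a fixed history lifts. -/
theorem twoLegCoreTD_klEng6_of_klEng5 {hist : TrigPolyC4v → ℕ → Prop} (h : TwoLegCoreTD L M hist klEngGeo5 P (klEngQ5 P R) R β U μ K n) :
    TwoLegCoreTD L M hist klEngGeo6 P (klEngQ6 P R) R β U μ K n :=
  klEng_twoLegCoreTD_raise_of _ _ _ _ h

/-- (E3a-MS-TQ) lifts (`R.WF`). -/
theorem twoLegSizesMSTQ_klEng6_of_klEng5 (hR : R.WF) (h : TwoLegSizesMSTQ L M klEngGeo5 (klEngQ5 P R) R β U μ K n) :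
    TwoLegSizesMSTQ L M klEngGeo6 (klEngQ6 P R) R β U μ K n :=
  klEng_twoLegSizesMSTQ_raise_of _ _ _ _ hR h

/-- **In-class (E2″-v7) at `(klEngGeo6, klEngQ6, klEngU₀4)` under the binders.** -/
theorem klvr11_pairValueIncrement_inClass_klEng6 (hP : P.WF) (hR : R.WF) {c : ℝ} (hU : 0 < U) (hU₀ : U ≤ klEngU₀4 P R c) (hn : 1 ≤ n)
    (hlad : PairLadderStepAtV10 L M klEngGeo6 P (klEngQ6 P R) β U μ K n) {G : GeoConsts}
    (hsplit : BetaSplitAtS2 L M G P (klEngQ6 P R) β U μ K (n - 1)) {Qm : TorusSite 2 L} (hQm : IsPairClassAt L Qm n) :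
    ∀ k ∈ klBall L μ K, ∀ k' ∈ klBall L μ K,
      ‖klPairAmplitude L M β U μ K n Qm k k' - klPairAmplitude L M β U μ K (n - 1) Qm k k'‖ ≤
        gainBar klEngGeo6 P U n (klTorusNorm L Qm) (klTorusNorm L (k - k')) (klTorusNorm L (k + k' - Qm)) +
          eremBar klEngGeo6 P (klEngQ6 P R) U β L (n - 1) + thermalBar klEngGeo6 P U β n +
            legDressBarQ2 klEngGeo6 P (klEngQ6 P R) U n (legSliceCountT L β μ K n ![k', Qm - k', Qm - k, k]) :=
  klvr11_pairValueIncrement_inClass_klEng_raise _ _ _ _ hP hR hU hU₀ hn hlad hsplit hQm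

end Model

end Summit.HubbardSuperconductivity.HubbardSuperconductivity.Theorems.EngineV8

end
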